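import Summits.ResolutionOfSingularities.ResolutionOfSingularities.Theorems.MarkedTransferCampaignW46MohWindowSurfaceChart
import HarnessLib

/-!
# [OURS · L1 W4.6 rung (iii-2), HEAVY-ROOT SIDE] Surface Moh window — the point of the Rees chart over a PRESCRIBED prime
# factor of the residue polynomial (cell res-hironaka, LADDER-RESOLUTION rung L, D-0089; seat res-L1-s46-pv-5 gen 4; host
# MarkedTransfer, `--supports stmt-ResolutionOfSingularities-16155 --as helper`; statement file `…CampaignW46MohWindowSurface.lean`)

HONEST FRAMING. Nothing here is a statement of H. Hironaka's manuscript [Hironaka2017] and nothing here asserts that any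
statement of it holds. PURE COMMUTATIVE ALGEBRA in the chart ring `B = R[𝔪/x]` of the blow-up of the closed point of a regular
local ring `R` (tree `Resolution/BlowupChartRsop.lean`: `chartRing`, `chartBase`, `chartGen`, `chartQuotEquiv`), the EXISTENCE
companion of res-D-pv-050 AS res-L1-s46-pv-12's `…MohWindowSurfaceChart.lean`: there a GIVEN prime `𝔴 ⊇ 𝔪B` is analysed and the
prime `π` of `κ[Y]` under it is read off; here a prime factor `π` of the residue polynomial `F̄ = Σ ā_k X^k` of a coefficient
window presentation is PRESCRIBED (with its cofactor: `F̄ = π · G₀`, `π ∤ G₀` — a SIMPLE factor) and the prime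
`𝔴 = ker (B → B/(x) ≅ κ[Y, Z] → κ[Y]/(π))` over it is CONSTRUCTED, together with the datum in every local ring `L` of `B` at `𝔴`:
`𝔪_L = (x, ρ, e₂)`, `Σ a_k e₁^k ≡ ρ · unit (mod x)` (`exists_prime_over_factor_of_chartDatum`, abstract; `exists_prime_over_factor`,
the Rees chart). This is the input of the top-of-window rigidity theorem (companions `…FreezeCore.lean`, ring level, and
`…Freeze.lean`, scheme level: the point of the blow-up over a simple root of a window point of residual order `2p − 1` is
singular and has no window presentation). [ZariskiSamuel1960] [Matsumura1987] AI-written; AI review is weaker than expert review.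
No `sorry`; axioms standard.
-/

noncomputable section

set_option linter.dupNamespace false -- mandated namespace of this single-conjunct summit

namespace Summit.ResolutionOfSingularities.ResolutionOfSingularities.Theorems.CampaignW46.MohWindowSurface

open IsLocalRing
open Literature.AlgebraicGeometry.Resolution

universe u

/-! ## 1. The chart datum at the prime over a GIVEN prime factor of the residue polynomial -/

section Chart

variable {R : Type u} [CommRing R]

open Polynomial in
/-- **[OURS · L1 W4.6 rung (iii-2), heavy side] Abstract chart datum with the prime PRESCRIBED.** `R` a local ring with residue
field `κ`; a «chart datum» (as in res-D-pv-050's `exists_core_data_of_chartDatum`): `φ : R → B`, an exceptional equation `t ∈ B`,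
letters `e : Fin 3 → B`, an identification `θ : κ[X_j : j ≠ 0] ≃ B/(t)` sending `ā ↦ φ a`, `X_j ↦ e_j`. Given coefficients
`a_k ∈ R` whose residue polynomial factors as `F̄ = Σ_{k ≤ d} ā_k X^k = π · G₀` with `π` prime and `π ∤ G₀` (a SIMPLE prime
factor), the kernel `𝔴` of `B → B/(t) ≅ κ[Y, Z] → κ[Y] → κ[Y]/(π)` (`Z ↦ 0`) is a prime of `B` over `𝔪_R` containing `e₂`, and
in EVERY local ring `L` of `B` at `𝔴`: `𝔪_L = (t, ρ, e₂)` and `Σ_k φ(a_k) e₁^k ≡ ρ · G (mod t)` with `G` a unit (`ρ` a lift of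
`π(e₁)`, `G` of `G₀(e₁)`). NOT a statement of the manuscript. [folklore] -/
theorem exists_prime_over_factor_of_chartDatum [IsLocalRing R] {B : Type u} [CommRing B] (φ : R →+* B) (t : B)
    (e : Fin 3 → B) (θ : MvPolynomial {j : Fin 3 // j ≠ 0} (ResidueField R) ≃+* B ⧸ Ideal.span {t})
    (hθC : ∀ r : R, θ (MvPolynomial.C (residue R r)) = Ideal.Quotient.mk (Ideal.span {t}) (φ r))
    (hθX : ∀ s : {j : Fin 3 // j ≠ 0}, θ (MvPolynomial.X s) = Ideal.Quotient.mk (Ideal.span {t}) (e s.1))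
    {d : ℕ} (a : ℕ → R) {π G₀ : (ResidueField R)[X]} (hπ : Prime π)
    (hF : ∑ k ∈ Finset.range (d + 1), Polynomial.C (residue R (a k)) * Polynomial.X ^ k = π * G₀) (hG₀ : ¬ π ∣ G₀) :
    ∃ 𝔴 : Ideal B, ∃ _ : 𝔴.IsPrime, 𝔴.comap φ = maximalIdeal R ∧ e 2 ∈ 𝔴 ∧
      ∀ (L : Type u) [CommRing L] [IsLocalRing L] [Algebra B L] [IsLocalization.AtPrime L 𝔴],
        ∃ ρ G : L, IsUnit G ∧
          Ideal.span {(algebraMap B L : B →+* L) t, ρ, (algebraMap B L : B →+* L) (e 2)} = maximalIdeal L ∧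
          (∑ k ∈ Finset.range (d + 1), (algebraMap B L : B →+* L) (φ (a k)) * (algebraMap B L : B →+* L) (e 1) ^ k) -
              ρ * G ∈ Ideal.span {(algebraMap B L : B →+* L) t} := by
  classical
  set sY : {j : Fin 3 // j ≠ 0} := ⟨1, by decide⟩ with hsY
  set sZ : {j : Fin 3 // j ≠ 0} := ⟨2, by decide⟩ with hsZ
  have hσ : ∀ s : {j : Fin 3 // j ≠ 0}, s = sY ∨ s = sZ :=
    subtype_eq_or_eq (i := 0) (i' := 1) (by decide) (by decide) (by decide)
  set mkK := Ideal.Quotient.mk (Ideal.span {t}) with hmkK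
  -- `ι : κ[X] → κ[Y, Z]`, `X ↦ Y`, and the retraction `ev₂ : κ[Y, Z] → κ[X]`, `Y ↦ X`, `Z ↦ 0`
  set ι : (ResidueField R)[X] →+* MvPolynomial {j : Fin 3 // j ≠ 0} (ResidueField R) :=
    (Polynomial.aeval (MvPolynomial.X sY) :
      (ResidueField R)[X] →ₐ[ResidueField R] MvPolynomial {j : Fin 3 // j ≠ 0} (ResidueField R)).toRingHom with hι
  have hιC : ∀ r : ResidueField R, ι (Polynomial.C r) = MvPolynomial.C r := fun r => by
    rw [hι, AlgHom.toRingHom_eq_coe, RingHom.coe_coe, Polynomial.aeval_C, MvPolynomial.algebraMap_eq]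
  have hιX : ι Polynomial.X = MvPolynomial.X sY := by
    rw [hι, AlgHom.toRingHom_eq_coe, RingHom.coe_coe, Polynomial.aeval_X]
  have hιa : ∀ Q : (ResidueField R)[X], (Polynomial.aeval (MvPolynomial.X sY) :
      (ResidueField R)[X] →ₐ[ResidueField R] MvPolynomial {j : Fin 3 // j ≠ 0} (ResidueField R)) Q = ι Q := fun Q => rfl
  set ev₂ : MvPolynomial {j : Fin 3 // j ≠ 0} (ResidueField R) →+* (ResidueField R)[X] :=
    (MvPolynomial.aeval (fun s : {j : Fin 3 // j ≠ 0} => if s = sY then (Polynomial.X : (ResidueField R)[X]) else 0) :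
      MvPolynomial {j : Fin 3 // j ≠ 0} (ResidueField R) →ₐ[ResidueField R] (ResidueField R)[X]).toRingHom with hev₂
  have hev₂C : ∀ r : ResidueField R, ev₂ (MvPolynomial.C r) = Polynomial.C r := fun r => by
    rw [hev₂, AlgHom.toRingHom_eq_coe, RingHom.coe_coe, MvPolynomial.aeval_C]
    exact (Polynomial.C_eq_algebraMap r).symm
  have hev₂Y : ev₂ (MvPolynomial.X sY) = Polynomial.X := by
    rw [hev₂, AlgHom.toRingHom_eq_coe, RingHom.coe_coe, MvPolynomial.aeval_X, if_pos rfl]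
  have hev₂Z : ev₂ (MvPolynomial.X sZ) = 0 := by
    rw [hev₂, AlgHom.toRingHom_eq_coe, RingHom.coe_coe, MvPolynomial.aeval_X, if_neg]
    intro h
    have := congrArg Subtype.val h
    simp [hsY, hsZ] at this
  have hev₂ι : ∀ Q : (ResidueField R)[X], ev₂ (ι Q) = Q := fun Q => by
    induction Q using Polynomial.induction_on' with
    | add P Q hP hQ => rw [map_add, map_add, hP, hQ]
    | monomial n r =>
      rw [← Polynomial.C_mul_X_pow_eq_monomial, map_mul, map_pow, hιC, hιX, map_mul, map_pow, hev₂C, hev₂Y]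
  -- the target domain `κ[X]/(π)` and the evaluation `B → κ[X]/(π)`
  set 𝔭 : Ideal (ResidueField R)[X] := Ideal.span {π} with h𝔭
  haveI h𝔭prime : 𝔭.IsPrime := (Ideal.span_singleton_prime hπ.ne_zero).mpr hπ
  haveI : IsDomain ((ResidueField R)[X] ⧸ 𝔭) := Ideal.Quotient.isDomain 𝔭
  set evπ : B →+* (ResidueField R)[X] ⧸ 𝔭 :=
    (Ideal.Quotient.mk 𝔭).comp (ev₂.comp (θ.symm.toRingHom.comp mkK)) with hevπ
  have hevπ_apply : ∀ b : B, evπ b = Ideal.Quotient.mk 𝔭 (ev₂ (θ.symm (mkK b))) := fun b => rfl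
  set 𝔴 : Ideal B := RingHom.ker evπ with h𝔴def
  haveI h𝔴prime : 𝔴.IsPrime := RingHom.ker_isPrime evπ
  -- membership: `b ∈ 𝔴 ↔ π ∣ ev₂ (θ⁻¹ b̄)`
  have hmem𝔴 : ∀ b : B, b ∈ 𝔴 ↔ π ∣ ev₂ (θ.symm (mkK b)) := fun b => by
    rw [h𝔴def, RingHom.mem_ker, hevπ_apply, Ideal.Quotient.eq_zero_iff_mem, h𝔭, Ideal.mem_span_singleton]
  have hθsymm : ∀ Q, θ.symm (θ Q) = Q := fun Q => θ.symm_apply_apply Q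
  -- (i) `t ∈ 𝔴`, (ii) `e₂ ∈ 𝔴`
  have ht𝔴 : t ∈ 𝔴 := by
    refine (hmem𝔴 t).mpr ?_
    have h0 : mkK t = 0 := Ideal.Quotient.eq_zero_iff_mem.mpr (Ideal.mem_span_singleton_self t)
    rw [h0, map_zero, map_zero]
    exact dvd_zero π
  have he2𝔴 : e 2 ∈ 𝔴 := by
    refine (hmem𝔴 (e 2)).mpr ?_
    have h0 : ev₂ (θ.symm (mkK (e 2))) = 0 := by
      rw [show mkK (e 2) = θ (MvPolynomial.X sZ) from (hθX sZ).symm, hθsymm, hev₂Z]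
    rw [h0]
    exact dvd_zero π
  -- (iii) `𝔴 ∩ R = 𝔪_R`
  have hcomap : 𝔴.comap φ = maximalIdeal R := by
    ext r
    have h0 : ev₂ (θ.symm (mkK (φ r))) = Polynomial.C (residue R r) := by
      rw [show mkK (φ r) = θ (MvPolynomial.C (residue R r)) from (hθC r).symm, hθsymm, hev₂C]
    rw [Ideal.mem_comap, hmem𝔴, h0]
    constructor
    · intro hdvd
      by_contra hr
      have hru : IsUnit (residue R r) := by
        rw [isUnit_iff_ne_zero, ne_eq, residue_eq_zero_iff]; exact hr
      exact hπ.not_unit (isUnit_of_dvd_unit hdvd (Polynomial.isUnit_C.mpr hru))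
    · intro hr
      rw [(residue_eq_zero_iff r).mpr hr, map_zero]
      exact dvd_zero π
  -- (iv) lifts `bπ ∈ 𝔴` of `π(e₁)` and `bG ∉ 𝔴` of `G₀(e₁)`
  obtain ⟨bπ, hbπ⟩ := Ideal.Quotient.mk_surjective (I := Ideal.span {t}) (θ (ι π))
  obtain ⟨bG, hbG⟩ := Ideal.Quotient.mk_surjective (I := Ideal.span {t}) (θ (ι G₀))
  have hbπ' : ev₂ (θ.symm (mkK bπ)) = π := by rw [show mkK bπ = θ (ι π) from hbπ, hθsymm, hev₂ι]
  have hbG' : ev₂ (θ.symm (mkK bG)) = G₀ := by rw [show mkK bG = θ (ι G₀) from hbG, hθsymm, hev₂ι]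
  have hbπ𝔴 : bπ ∈ 𝔴 := (hmem𝔴 bπ).mpr (hbπ' ▸ dvd_rfl)
  have hbG𝔴 : bG ∉ 𝔴 := fun h => hG₀ (hbG' ▸ (hmem𝔴 bG).mp h)
  -- (v) `𝔴 = (e₂, bπ) + (t)`
  have h𝔴eq : 𝔴 = Ideal.span {e 2, bπ} ⊔ Ideal.span {t} := by
    apply le_antisymm
    · intro b hb
      obtain ⟨Q₁, Q₀, hQ⟩ := exists_eq_X_mul_add_aeval sY sZ hσ (θ.symm (mkK b))
      have hQ₀ : π ∣ Q₀ := by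
        have := (hmem𝔴 b).mp hb
        rwa [hQ, map_add, map_mul, hev₂Z, zero_mul, zero_add, hιa, hev₂ι] at this
      obtain ⟨Q₂, rfl⟩ := hQ₀
      obtain ⟨b₁, hb₁⟩ := Ideal.Quotient.mk_surjective (I := Ideal.span {t}) (θ Q₁)
      obtain ⟨b₂, hb₂⟩ := Ideal.Quotient.mk_surjective (I := Ideal.span {t}) (θ (ι Q₂))
      have hbb : mkK b = mkK (e 2 * b₁ + bπ * b₂) := by
        have h1 : mkK b = θ (MvPolynomial.X sZ * Q₁ + ι (π * Q₂)) := by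
          rw [← hιa, ← hQ, θ.apply_symm_apply]
        rw [h1, map_add, map_mul, map_mul, map_mul, hθX sZ, ← hbπ, ← hb₁, ← hb₂, hmkK, map_add, map_mul, map_mul]
      rw [hmkK, Ideal.Quotient.eq] at hbb
      have : b = (e 2 * b₁ + bπ * b₂) + (b - (e 2 * b₁ + bπ * b₂)) := by ring
      rw [this]
      refine Submodule.add_mem_sup ?_ hbb
      exact Ideal.add_mem _ (Ideal.mul_mem_right _ _ (Ideal.subset_span (Set.mem_insert _ _)))
        (Ideal.mul_mem_right _ _ (Ideal.subset_span (Set.mem_insert_of_mem _ (Set.mem_singleton _))))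
    · refine sup_le ?_ ?_
      · rw [Ideal.span_le]
        rintro b (rfl | rfl)
        · exact he2𝔴
        · exact hbπ𝔴
      · rw [Ideal.span_le, Set.singleton_subset_iff]; exact ht𝔴
  -- (vi) the chart element reduces to `θ (ι F̄) = θ (ι π) · θ (ι G₀)`
  set fB : B := ∑ k ∈ Finset.range (d + 1), φ (a k) * e 1 ^ k with hfB
  have hfBbar : mkK fB = θ (ι (∑ k ∈ Finset.range (d + 1), Polynomial.C (residue R (a k)) * Polynomial.X ^ k)) := by
    rw [hfB, map_sum, map_sum, map_sum]
    refine Finset.sum_congr rfl fun k _ => ?_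
    rw [map_mul, map_pow, map_mul, map_pow, hιC, hιX, θ.map_mul, θ.map_pow, hθC, hθX]
  have hdiffK : fB - bπ * bG ∈ Ideal.span {t} := by
    rw [← Ideal.Quotient.eq, hfBbar, hF, map_mul, θ.map_mul, map_mul, hbπ, hbG]
  -- transport to any local ring `L` of `B` at `𝔴`
  refine ⟨𝔴, h𝔴prime, hcomap, he2𝔴, fun L _ _ _ _ => ?_⟩
  have hmem : ∀ b : B, (algebraMap B L : B →+* L) b ∈ maximalIdeal L ↔ b ∈ 𝔴 := fun b =>
    IsLocalization.AtPrime.to_map_mem_maximal_iff L 𝔴 b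
  have hunit : ∀ b : B, IsUnit ((algebraMap B L : B →+* L) b) ↔ b ∉ 𝔴 := fun b =>
    IsLocalization.AtPrime.isUnit_to_map_iff L 𝔴 b
  have hmL : maximalIdeal L = 𝔴.map (algebraMap B L : B →+* L) := (IsLocalization.AtPrime.map_eq_maximalIdeal 𝔴 L).symm
  refine ⟨(algebraMap B L : B →+* L) bπ, (algebraMap B L : B →+* L) bG, (hunit bG).mpr hbG𝔴, ?_, ?_⟩
  · -- `𝔪_L = (t, ρ, e₂)`
    apply le_antisymm
    · rw [Ideal.span_le]
      rintro b (rfl | rfl | rfl)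
      · exact (hmem _).mpr ht𝔴
      · exact (hmem _).mpr hbπ𝔴
      · exact (hmem _).mpr he2𝔴
    · rw [hmL, h𝔴eq, Ideal.map_sup, Ideal.map_span, Set.image_insert_eq, Set.image_singleton, Ideal.map_span,
        Set.image_singleton]
      refine sup_le ?_ ?_
      · rw [Ideal.span_le]
        rintro b (rfl | rfl)
        · exact Ideal.subset_span (Set.mem_insert_of_mem _ (Set.mem_insert_of_mem _ (Set.mem_singleton _)))
        · exact Ideal.subset_span (Set.mem_insert_of_mem _ (Set.mem_insert _ _))
      · rw [Ideal.span_le, Set.singleton_subset_iff]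
        exact Ideal.subset_span (Set.mem_insert _ _)
  · -- `Σ a_k e₁^k − ρ G ∈ (t)`
    obtain ⟨r, hr⟩ := Ideal.mem_span_singleton'.mp hdiffK
    have himg : (algebraMap B L : B →+* L) fB - (algebraMap B L : B →+* L) bπ * (algebraMap B L : B →+* L) bG =
        (algebraMap B L : B →+* L) r * (algebraMap B L : B →+* L) t := by
      rw [← map_mul, ← map_sub, ← hr, map_mul]
    have hfBimg : (algebraMap B L : B →+* L) fB =
        ∑ k ∈ Finset.range (d + 1), (algebraMap B L : B →+* L) (φ (a k)) * (algebraMap B L : B →+* L) (e 1) ^ k := by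
      rw [hfB, map_sum]
      refine Finset.sum_congr rfl fun k _ => ?_
      rw [map_mul, map_pow]
    rw [← hfBimg, himg]
    exact Ideal.mul_mem_left _ _ (Ideal.mem_span_singleton_self _)

open Polynomial in
/-- **[OURS · L1 W4.6 rung (iii-2), heavy side] The Rees chart over a window point is such a datum**: for `R` regular local of
embedding dimension `3` with regular system of parameters `c = (x, y, z)` and coefficients `a_k` whose residue polynomial has
the simple prime factor `π` (`F̄ = π G₀`, `π ∤ G₀`), the `x`-chart ring `B = R[𝔪/x]` has a prime `𝔴` over `𝔪_R` containing
`e₂ = z/x` such that in every local ring `L` of `B` at `𝔴`: `𝔪_L = (x, ρ, e₂)`, `Σ a_k e₁^k ≡ ρ G (mod x)`, `G` a unit. NOT a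
statement of the manuscript. [folklore] -/
theorem exists_prime_over_factor [IsRegularLocalRing R] (h3 : (maximalIdeal R).spanFinrank = 3) (c : Fin 3 → R)
    (hc : Ideal.span (Set.range c) = maximalIdeal R) {d : ℕ} (a : ℕ → R) {π G₀ : (ResidueField R)[X]} (hπ : Prime π)
    (hF : ∑ k ∈ Finset.range (d + 1), Polynomial.C (residue R (a k)) * Polynomial.X ^ k = π * G₀) (hG₀ : ¬ π ∣ G₀) :
    ∃ 𝔴 : Ideal (chartRing c 0), ∃ _ : 𝔴.IsPrime, 𝔴.comap (chartBase c 0) = maximalIdeal R ∧ chartGen c 0 2 ∈ 𝔴 ∧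
      ∀ (L : Type u) [CommRing L] [IsLocalRing L] [Algebra (chartRing c 0) L] [IsLocalization.AtPrime L 𝔴],
        ∃ ρ G : L, IsUnit G ∧
          Ideal.span {(algebraMap (chartRing c 0) L : chartRing c 0 →+* L) (chartBase c 0 (c 0)), ρ,
              (algebraMap (chartRing c 0) L : chartRing c 0 →+* L) (chartGen c 0 2)} = maximalIdeal L ∧
          (∑ k ∈ Finset.range (d + 1), (algebraMap (chartRing c 0) L : chartRing c 0 →+* L) (chartBase c 0 (a k)) *
              (algebraMap (chartRing c 0) L : chartRing c 0 →+* L) (chartGen c 0 1) ^ k) - ρ * G ∈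
            Ideal.span {(algebraMap (chartRing c 0) L : chartRing c 0 →+* L) (chartBase c 0 (c 0))} := by
  classical
  have hz0 : Ideal.span (Set.range (Fin.append c (fun k : Fin 0 => Fin.elim0 k : Fin 0 → R))) = maximalIdeal R := by
    rw [span_range_append_elim0]; exact hc
  have hd0 : (maximalIdeal R).spanFinrank = 3 + 0 := by rw [h3]
  have hqr : IsQuasiRegular c := isQuasiRegular_centre c (fun k : Fin 0 => Fin.elim0 k) hz0 hd0
  let θ : MvPolynomial {j : Fin 3 // j ≠ 0} (ResidueField R) ≃+* chartRing c 0 ⧸ Ideal.span {chartBase c 0 (c 0)} :=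
    (MvPolynomial.mapEquiv {j : Fin 3 // j ≠ 0} (Ideal.quotEquivOfEq hc).symm).trans (chartQuotEquiv c 0 hqr)
  have hθC : ∀ r : R, θ (MvPolynomial.C (residue R r)) =
      Ideal.Quotient.mk (Ideal.span {chartBase c 0 (c 0)}) (chartBase c 0 r) := fun r => by
    show chartQuotMap c 0 (MvPolynomial.map (Ideal.quotEquivOfEq hc).symm.toRingHom (MvPolynomial.C (residue R r))) = _
    have : (Ideal.quotEquivOfEq hc).symm.toRingHom (residue R r) = Ideal.Quotient.mk (Ideal.span (Set.range c)) r := by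
      show (Ideal.quotEquivOfEq hc).symm (Ideal.Quotient.mk (maximalIdeal R) r) = _
      rw [Ideal.quotEquivOfEq_symm, Ideal.quotEquivOfEq_mk]
    rw [MvPolynomial.map_C, this, chartQuotMap_C]
  have hθX : ∀ s : {j : Fin 3 // j ≠ 0}, θ (MvPolynomial.X s) =
      Ideal.Quotient.mk (Ideal.span {chartBase c 0 (c 0)}) (chartGen c 0 s.1) := fun s => by
    show chartQuotMap c 0 (MvPolynomial.map (Ideal.quotEquivOfEq hc).symm.toRingHom (MvPolynomial.X s)) = _
    rw [MvPolynomial.map_X, chartQuotMap_X]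
  exact exists_prime_over_factor_of_chartDatum (chartBase c 0) (chartBase c 0 (c 0)) (chartGen c 0) θ hθC hθX a hπ hF hG₀

end Chart

end Summit.ResolutionOfSingularities.ResolutionOfSingularities.Theorems.CampaignW46.MohWindowSurface

end
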